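import Mathlib
import Literature.Probability.MarkovChains.TotalVariation
import Summits.Ventures.LatticeQCDFlow.Exactness.FlowMCMC
import Summits.Ventures.LatticeQCDFlow.Exactness.JarzynskiFinite
import Summits.Ventures.LatticeQCDFlow.Exactness.QuasiStaticDissipation
import Summits.Ventures.LatticeQCDFlow.Exactness.ThermodynamicIntegration
import Summits.Ventures.LatticeQCDFlow.Scaling.AcceptancePinskerFloor
import Summits.Ventures.LatticeQCDFlow.Scaling.AcceptanceTransfer

/-!
# LatticeQCDFlow / Scaling — acceptance transfer along a LINEAR Gibbs ladder `S_c = S₀ + c·A`: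
# the carried acceptance degrades at most linearly in the coupling step, with slope `√(sup Var A)`

HONEST FRAMING: exact (Metropolis-corrected) sampling algorithms for lattice gauge theory;
figures of merit are autocorrelation/cost numbers at stated couplings and volumes; no
continuum-physics claim.

Venture `LatticeQCDFlow` (cell pub-lqcd), topic `Scaling`; FANOUT row 3 (`s0-u1-a`, S0-B
implementation A, GEN-5).  NEW WORK of the cell, not a published result; NO definition is
introduced.  Continuation of row 3's `Scaling/AcceptanceTransfer.lean` (`accRate_gibbs_transfer`:
`acc(π_{S₁}, q) ≥ acc(π_{S₀}, q) − √J(π_{S₀}, π_{S₁})` for ANY normalised model `q`) in the tree's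
vocabulary for linear protocols — `Exactness.linAction S₀ A c = S₀ + c·A`, `meanD S₀ A c = ⟨A⟩_c`,
`varD S₀ A c = Var_c(A)` (`Exactness/QuasiStaticDissipation`, `Exactness/ThermodynamicIntegration`,
row 8) — using the tree's fluctuation–response identity `meanD_sub_eq_integral`
(`⟨A⟩_b − ⟨A⟩_a = −∫_a^b Var_c(A) dc`).

## Content

* `accRate_sub_two_mul_tvDist_le_accRate_right` — the model-slot twin of the target-slot floor of
  `Scaling/AcceptanceTransfer` (`acc(p, q') ≥ acc(p, q) − 2‖q − q'‖_TV`, by `accRate_comm`): moving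
  the model — e.g. from one training checkpoint to the next — by `‖q − q'‖_TV` costs at most twice
  that in equilibrium acceptance.
* `jeffreys_linAction_eq`, `jeffreys_linAction_eq_integral` — along the linear family the Jeffreys
  sum between the laws at couplings `a`, `b` is `(b − a)(⟨A⟩_a − ⟨A⟩_b) = (b − a)·∫_a^b Var_c(A) dc`.
* **`accRate_linAction_transfer`** — `acc(π_b, q) ≥ acc(π_a, q) − √((b − a)(⟨A⟩_a − ⟨A⟩_b))`.
* **`accRate_linAction_transfer_of_varD_le` (the carried-acceptance WINDOW LAW)** — if
  `Var_c(A) ≤ σ²` for every `c` between `a` and `b`, then for ANY non-negative normalised model `q`: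
  `acc(π_b, q) ≥ acc(π_a, q) − |b − a|·√σ²`.

Reading (value-free; no number of record moves, nothing is re-scored): for an extensive ladder
observable (`A` = a sum over `V` plaquettes, `Var_c A = V·χ_c`) the acceptance a trained flow is
GUARANTEED to keep when re-used, un-retrained, at a coupling `|b − a|` away is its own minus at most
`|b − a|·√(V·sup χ)`: the carried-acceptance window `|b − a| ≲ Δacc/√(V·χ)` shrinks like `V^{−1/2}`,
the acceptance twin of the reweighting window of `Scaling/AnnealingStepLaw` (`ess_step_le`, T2-AA).
A unit step in `β` at `16²` lies far outside any such window — the warm start of a bootstrapped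
training ladder (arm A: weights trained at β = 3 initialising β ∈ {1, 2, 4, 5, 6}) carries no
acceptance guarantee at that step size, and each rung has to be re-trained, as the protocol did.
NOT CLAIMED: any value of `χ`, `V`, `σ²` or of an acceptance of ours; that the slope `√σ²` is
optimal; anything about `τ_int`, ESS or per-sector weights; the sampling error of a finite-sample
acceptance monitor (the law concerns the equilibrium expectation `accRate`).

Elementary (`[folklore]`-level); farm `lean check` rc 0, no `sorry`.
-/

namespace Summit.Ventures.LatticeQCDFlow.Theory2

open Finset
open Literature.Probability.MarkovChains
open Summit.Ventures.LatticeQCDFlow.Exactness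

variable {X : Type*} [Fintype X]

/-- **Transfer floor, model slot (readable form).**  `acc(p, q') ≥ acc(p, q) − 2‖q − q'‖_TV` for a
non-negative normalised target `p` and normalised models `q`, `q'`. [folklore] -/
theorem accRate_sub_two_mul_tvDist_le_accRate_right {p q q' : X → ℝ} (hp : ∀ x, 0 ≤ p x)
    (hp1 : ∑ x, p x = 1) (hq1 : ∑ x, q x = 1) (hq'1 : ∑ x, q' x = 1) :
    accRate p q - 2 * tvDist q q' ≤ accRate p q' := by
  rw [accRate_comm p q, accRate_comm p q']
  exact accRate_sub_two_mul_tvDist_le_accRate hq1 hq'1 hp hp1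

/-! ### The linear ladder `S_c = S₀ + c·A` -/

/-- Along the linear family `S_c = S₀ + c·A` the Jeffreys sum between the laws at couplings `a`
and `b` is `(b − a)(⟨A⟩_a − ⟨A⟩_b)`. [folklore] -/
theorem jeffreys_linAction_eq [Nonempty X] (S₀ A : X → ℝ) (a b : ℝ) :
    ∑ x, (gibbsLaw (linAction S₀ A a) x - gibbsLaw (linAction S₀ A b) x) *
        (linAction S₀ A b x - linAction S₀ A a x) =
      (b - a) * (meanD S₀ A a - meanD S₀ A b) := by
  simp only [meanD, gibbsMean, linAction]
  rw [mul_sub, mul_sum, mul_sum, ← sum_sub_distrib]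
  exact sum_congr rfl fun x _ => by ring

/-- … and by fluctuation–response (`meanD_sub_eq_integral`: `⟨A⟩_b − ⟨A⟩_a = −∫_a^b Var_c(A) dc`)
it is `(b − a)·∫_a^b Var_c(A) dc`. [folklore] -/
theorem jeffreys_linAction_eq_integral [Nonempty X] (S₀ A : X → ℝ) (a b : ℝ) :
    ∑ x, (gibbsLaw (linAction S₀ A a) x - gibbsLaw (linAction S₀ A b) x) *
        (linAction S₀ A b x - linAction S₀ A a x) =
      (b - a) * ∫ c in a..b, varD S₀ A c := by
  rw [jeffreys_linAction_eq, show meanD S₀ A a - meanD S₀ A b = -(meanD S₀ A b - meanD S₀ A a) by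
    ring, meanD_sub_eq_integral, neg_neg]

/-- **Acceptance transfer along a linear ladder step.**  For `S_c = S₀ + c·A` and ANY non-negative
normalised model `q`:  `acc(π_b, q) ≥ acc(π_a, q) − √((b − a)(⟨A⟩_a − ⟨A⟩_b))`. [folklore] -/
theorem accRate_linAction_transfer [Nonempty X] (S₀ A : X → ℝ) (a b : ℝ) {q : X → ℝ}
    (hq : ∀ x, 0 ≤ q x) (hq1 : ∑ x, q x = 1) :
    accRate (gibbsLaw (linAction S₀ A a)) q -
        Real.sqrt ((b - a) * (meanD S₀ A a - meanD S₀ A b)) ≤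
      accRate (gibbsLaw (linAction S₀ A b)) q := by
  have key := accRate_gibbs_transfer (linAction S₀ A a) (linAction S₀ A b) hq hq1
  rwa [jeffreys_linAction_eq] at key

/-- **The carried-acceptance WINDOW LAW.**  For `S_c = S₀ + c·A`: if the variance of the ladder
observable is at most `σ²` at every coupling between `a` and `b`, then for ANY non-negative
normalised model `q`
`acc(π_b, q) ≥ acc(π_a, q) − |b − a|·√σ²` — the acceptance guaranteed to survive a ladder step
degrades at most linearly in the step, with slope `√(sup Var A)` (`= √(V·χ)` for an extensive `A`).
[folklore] -/
theorem accRate_linAction_transfer_of_varD_le [Nonempty X] (S₀ A : X → ℝ) {a b σ2 : ℝ}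
    (hV : ∀ c ∈ Set.uIcc a b, varD S₀ A c ≤ σ2) {q : X → ℝ} (hq : ∀ x, 0 ≤ q x)
    (hq1 : ∑ x, q x = 1) :
    accRate (gibbsLaw (linAction S₀ A a)) q - |b - a| * Real.sqrt σ2 ≤
      accRate (gibbsLaw (linAction S₀ A b)) q := by
  have key := accRate_gibbs_transfer (linAction S₀ A a) (linAction S₀ A b) hq hq1
  rw [jeffreys_linAction_eq_integral] at key
  have hσ : 0 ≤ σ2 := (varD_nonneg S₀ A a).trans (hV a Set.left_mem_uIcc)
  -- `|∫_a^b Var_c dc| ≤ σ² |b − a|`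
  have hI : |∫ c in a..b, varD S₀ A c| ≤ σ2 * |b - a| := by
    have h := intervalIntegral.norm_integral_le_of_norm_le_const (a := a) (b := b) (C := σ2)
      (f := varD S₀ A) fun c hc => by
        rw [Real.norm_eq_abs, abs_of_nonneg (varD_nonneg S₀ A c)]
        exact hV c (Set.uIoc_subset_uIcc hc)
    simpa only [Real.norm_eq_abs] using h
  -- hence `J ≤ σ² (b − a)²` and `√J ≤ |b − a| √σ²`
  have hJ : (b - a) * ∫ c in a..b, varD S₀ A c ≤ σ2 * (b - a) ^ 2 :=
    calc (b - a) * ∫ c in a..b, varD S₀ A c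
        ≤ |(b - a) * ∫ c in a..b, varD S₀ A c| := le_abs_self _
      _ = |b - a| * |∫ c in a..b, varD S₀ A c| := abs_mul _ _
      _ ≤ |b - a| * (σ2 * |b - a|) := mul_le_mul_of_nonneg_left hI (abs_nonneg _)
      _ = σ2 * (b - a) ^ 2 := by rw [← sq_abs (b - a)]; ring
  have hsqrt : Real.sqrt ((b - a) * ∫ c in a..b, varD S₀ A c) ≤ |b - a| * Real.sqrt σ2 :=
    calc Real.sqrt ((b - a) * ∫ c in a..b, varD S₀ A c)
        ≤ Real.sqrt (σ2 * (b - a) ^ 2) := Real.sqrt_le_sqrt hJ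
      _ = Real.sqrt σ2 * |b - a| := by rw [Real.sqrt_mul hσ, Real.sqrt_sq_eq_abs]
      _ = |b - a| * Real.sqrt σ2 := mul_comm _ _
  linarith

end Summit.Ventures.LatticeQCDFlow.Theory2
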